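import Mathlib.Data.Nat.Choose.Sum
import Mathlib.Data.Matrix.Basic
import Mathlib.LinearAlgebra.Matrix.Determinant.Basic
import Summits.CriticalPhenomena.PercolationContinuityZ3.Theorems.PercNearOneGluingNoHeavyLowerTailAntiBandCoveringDet

/-!
# `NoHeavyLowerTail` (crux stmt-CriticalPhenomena-4575), lane prim-ineq-gen-4 (gen 26): the middle-level form of the binomial matrix at the diagonal

Support file (`--supports stmt-CriticalPhenomena-4575`; memo `run/shared/lean/prim/prim-ineq-gen-4/FINDING-SPECTRAL-GAP-g26.md` §0(1), PROP 1).
Pure finite combinatorics / matrix algebra over `ℤ`, no definitions, no `sorry`, standard axioms.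

Setting.  `|β| = 2k+2`, `U` a family of finsets of size `≤ k` that is up-closed inside the ball (`x ∈ U`, `x ⊆ z`, `#z ≤ k ⇒ z ∈ U`),
`Y` the middle level (`(k+1)`-subsets of `β`).  With `V[y,x] = [x ⊆ y]` (`y ∈ Y`, `x ∈ U`), `Z[z,x] = [x ⊆ z]` (`z, x ∈ U`) and `S = diag (−1)^{k − #z}`:
`Vᵀ V − Zᵀ S Z = [C(2k+1−#(x∪x'), k)]_{x,x'∈U}` — the binomial matrix `M_U` of the determinant criterion (g21) is the Gram matrix of the
middle-level incidence vectors minus a unitriangular congruence of the signature matrix `S` (so `M_U` is integrally congruent to `P_U − S_U`,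
`P_U = VᵀV`, and `|det M_U| = |det(I − V S Vᵀ)|`; memo PROP 1).  Entrywise this is the pair of counting identities
`#{y ∈ Y : x∪x' ⊆ y} = C(2k+2−s, k+1−s)` and `∑_{z ∈ U, x∪x' ⊆ z} (−1)^{k−#z} = C(2k+1−s, k−s)` (`s = #(x∪x') ≤ k`; up-closure) plus Pascal's rule.

Main statement: `gram_sub_zeta_sign_zeta_eq_binomial`.
-/

namespace Summit.CriticalPhenomena.PercolationContinuityZ3.Theorems.AntiBandMiddleLevel

open Finset Matrix

variable {β : Type*} [DecidableEq β] [Fintype β]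

omit [DecidableEq β] [Fintype β] in
/-- `(−1)^(a−b) = (−1)^a (−1)^b` for `b ≤ a`. [elementary] -/
theorem neg_one_pow_sub_eq_mul (a b : ℕ) (h : b ≤ a) : (-1 : ℤ) ^ (a - b) = (-1 : ℤ) ^ a * (-1 : ℤ) ^ b := by
  obtain ⟨c, rfl⟩ := Nat.exists_eq_add_of_le h
  rw [Nat.add_sub_cancel_left, pow_add, mul_comm ((-1 : ℤ) ^ b), mul_assoc, ← pow_add, ← two_mul, pow_mul]
  simp

/-- The number of `m`-subsets of `β` containing a fixed finset `w` with `#w ≤ m` is `C(|β| − #w, m − #w)`. [elementary] -/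
theorem card_filter_powersetCard_superset (w : Finset β) (m : ℕ) (hw : #w ≤ m) :
    #(((univ : Finset β).powersetCard m).filter (fun y => w ⊆ y)) = (Fintype.card β - #w).choose (m - #w) := by
  rw [← Finset.card_compl w, ← Finset.card_powersetCard (m - #w) wᶜ]
  symm
  apply Finset.card_bij' (fun u _ => u ∪ w) (fun y _ => y \ w)
  · intro u hu
    rw [mem_powersetCard] at hu
    have hdisj : Disjoint u w := by
      rw [← Finset.subset_compl_iff_disjoint_right]; exact hu.1
    rw [mem_filter, mem_powersetCard]
    refine ⟨⟨subset_univ _, ?_⟩, subset_union_right⟩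
    rw [card_union_of_disjoint hdisj, hu.2]
    omega
  · intro y hy
    rw [mem_filter, mem_powersetCard] at hy
    rw [mem_powersetCard]
    refine ⟨?_, ?_⟩
    · intro a ha
      rw [mem_sdiff] at ha
      rw [mem_compl]
      exact ha.2
    · rw [card_sdiff_of_subset hy.2, hy.1.2]
  · intro u hu
    rw [mem_powersetCard] at hu
    have hdisj : Disjoint u w := by
      rw [← Finset.subset_compl_iff_disjoint_right]; exact hu.1
    exact Finset.union_sdiff_cancel_right hdisj
  · intro y hy
    rw [mem_filter] at hy
    exact Finset.sdiff_union_of_subset hy.2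

/-- No `m`-subset contains a finset with more than `m` elements. [elementary] -/
theorem filter_powersetCard_superset_eq_empty (w : Finset β) (m : ℕ) (hw : m < #w) :
    ((univ : Finset β).powersetCard m).filter (fun y => w ⊆ y) = ∅ := by
  rw [Finset.filter_eq_empty_iff]
  intro y hy hwy
  rw [mem_powersetCard] at hy
  have := Finset.card_le_card hwy
  omega

/-- Up-closure inside the ball: for `x ∈ U` and `w ⊇ x` with `#w ≤ k`, `∑_{z ∈ U, w ⊆ z} (−1)^{k − #z} = C(|β| − 1 − #w, k − #w)`
(the members of `U` above `w` are all sets `w ⊔ u`, `u ⊆ wᶜ`, `#u ≤ k − #w`; then the truncated alternating sum of g21's file). [memo PROP 1] -/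
theorem sum_filter_superset_neg_one_pow (k : ℕ) (U : Finset (Finset β)) (hUk : ∀ z ∈ U, #z ≤ k)
    (hup : ∀ x ∈ U, ∀ z : Finset β, x ⊆ z → #z ≤ k → z ∈ U) (x w : Finset β) (hx : x ∈ U) (hxw : x ⊆ w) (hwk : #w ≤ k)
    (hβ : #w < Fintype.card β) :
    ∑ z ∈ U.filter (fun z => w ⊆ z), (-1 : ℤ) ^ (k - #z) = ((Fintype.card β - 1 - #w).choose (k - #w) : ℤ) := by
  have hne : (wᶜ : Finset β).Nonempty := by
    rw [← Finset.card_pos, Finset.card_compl]; omega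
  have key : ∑ z ∈ U.filter (fun z => w ⊆ z), (-1 : ℤ) ^ (k - #z)
      = ∑ u ∈ (wᶜ : Finset β).powerset.filter (fun u => #u ≤ k - #w), (-1 : ℤ) ^ (k - #w) * (-1 : ℤ) ^ #u := by
    apply Finset.sum_bij' (fun z _ => z \ w) (fun u _ => u ∪ w)
    · intro z hz
      rw [mem_filter] at hz
      rw [mem_filter, mem_powerset]
      refine ⟨?_, ?_⟩
      · intro a ha
        rw [mem_sdiff] at ha
        rw [mem_compl]
        exact ha.2
      · rw [card_sdiff_of_subset hz.2]
        have := hUk z hz.1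
        omega
    · intro u hu
      rw [mem_filter, mem_powerset] at hu
      have hdisj : Disjoint u w := by
        rw [← Finset.subset_compl_iff_disjoint_right]; exact hu.1
      have hcard : #(u ∪ w) = #u + #w := card_union_of_disjoint hdisj
      rw [mem_filter]
      refine ⟨hup x hx (u ∪ w) (hxw.trans subset_union_right) (by omega), subset_union_right⟩
    · intro z hz
      rw [mem_filter] at hz
      exact Finset.sdiff_union_of_subset hz.2
    · intro u hu
      rw [mem_filter, mem_powerset] at hu
      have hdisj : Disjoint u w := by
        rw [← Finset.subset_compl_iff_disjoint_right]; exact hu.1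
      exact Finset.union_sdiff_cancel_right hdisj
    · intro z hz
      rw [mem_filter] at hz
      have hzk := hUk z hz.1
      have hcard : #(z \ w) = #z - #w := card_sdiff_of_subset hz.2
      have hwz : #w ≤ #z := Finset.card_le_card hz.2
      rw [hcard]
      have h1 : k - #z = (k - #w) - (#z - #w) := by omega
      rw [h1, neg_one_pow_sub_eq_mul _ _ (by omega)]
  rw [key, ← Finset.mul_sum,
    Summit.CriticalPhenomena.PercolationContinuityZ3.Theorems.AntiBandCoveringDet.sum_neg_one_pow_powerset_card_le _ _ hne,
    ← mul_assoc, ← pow_add, ← two_mul, pow_mul]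
  simp only [neg_one_sq, one_pow, one_mul, Finset.card_compl]
  congr 2
  omega

/-- THE MIDDLE-LEVEL FORM (memo FINDING-SPECTRAL-GAP-g26 PROP 1).  `|β| = 2k+2`, `U` up-closed inside the ball of radius `k`, `Y` the middle level:
`Vᵀ V − Zᵀ S Z = [C(2k+1 − #(x∪x'), k)]_{x,x' ∈ U}` with `V[y,x] = [x ⊆ y]`, `Z[z,x] = [x ⊆ z]`, `S = diag (−1)^{k−#z}`.
Hence the binomial matrix of the (AB) determinant criterion is integrally congruent to `VᵀV − S` conjugated by the unitriangular `Z`,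
and `|det M_U| = |det (1 − V S Vᵀ)|` on the middle level. -/
theorem gram_sub_zeta_sign_zeta_eq_binomial (k : ℕ) (hβ : Fintype.card β = 2 * k + 2) (U : Finset (Finset β))
    (hUk : ∀ x ∈ U, #x ≤ k) (hup : ∀ x ∈ U, ∀ z : Finset β, x ⊆ z → #z ≤ k → z ∈ U) :
    (Matrix.of fun (y : ↥((univ : Finset β).powersetCard (k + 1))) (x : ↥U) => if (x : Finset β) ⊆ y then (1 : ℤ) else 0)ᵀ *
        (Matrix.of fun (y : ↥((univ : Finset β).powersetCard (k + 1))) (x : ↥U) => if (x : Finset β) ⊆ y then (1 : ℤ) else 0)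
      - (Matrix.of fun (z x : ↥U) => if (x : Finset β) ⊆ z then (1 : ℤ) else 0)ᵀ *
        (Matrix.diagonal fun (z : ↥U) => (-1 : ℤ) ^ (k - #(z : Finset β))) *
        (Matrix.of fun (z x : ↥U) => if (x : Finset β) ⊆ z then (1 : ℤ) else 0)
      = Matrix.of fun (x x' : ↥U) => ((2 * k + 1 - #((x : Finset β) ∪ x')).choose k : ℤ) := by
  ext x x'
  set Y : Finset (Finset β) := (univ : Finset β).powersetCard (k + 1) with hYdef
  rw [Matrix.sub_apply, Matrix.mul_apply, Matrix.mul_apply, Matrix.of_apply]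
  simp only [Matrix.mul_diagonal, transpose_apply, of_apply]
  set w : Finset β := (x : Finset β) ∪ x' with hwdef
  have hwle : #w ≤ 2 * k :=
    (Finset.card_union_le _ _).trans (by have := hUk x x.2; have := hUk x' x'.2; omega)
  -- the Gram term: number of middle sets above `w`
  have hV : ∑ y : ↥Y, ((if (x : Finset β) ⊆ (y : Finset β) then (1 : ℤ) else 0) *
        (if (x' : Finset β) ⊆ (y : Finset β) then (1 : ℤ) else 0))
      = (#(Y.filter (fun y => w ⊆ y)) : ℤ) := by
    have h1 : ∑ y : ↥Y, ((if (x : Finset β) ⊆ (y : Finset β) then (1 : ℤ) else 0) *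
          (if (x' : Finset β) ⊆ (y : Finset β) then (1 : ℤ) else 0))
        = ∑ y ∈ Y, (if w ⊆ y then (1 : ℤ) else 0) := by
      rw [univ_eq_attach, Finset.sum_attach Y (fun y => (if (x : Finset β) ⊆ y then (1 : ℤ) else 0) *
        (if (x' : Finset β) ⊆ y then (1 : ℤ) else 0))]
      apply Finset.sum_congr rfl
      intro y _
      have hiff : w ⊆ y ↔ (x : Finset β) ⊆ y ∧ (x' : Finset β) ⊆ y := by rw [hwdef, Finset.union_subset_iff]
      by_cases h1 : (x : Finset β) ⊆ (y : Finset β) <;> by_cases h2 : (x' : Finset β) ⊆ (y : Finset β)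
      · have h3 : w ⊆ y := hiff.2 ⟨h1, h2⟩
        simp [h1, h2, h3]
      · have h3 : ¬ w ⊆ y := fun h => h2 (hiff.1 h).2
        simp [h1, h2, h3]
      · have h3 : ¬ w ⊆ y := fun h => h1 (hiff.1 h).1
        simp [h1, h2, h3]
      · have h3 : ¬ w ⊆ y := fun h => h1 (hiff.1 h).1
        simp [h1, h2, h3]
    rw [h1, Finset.sum_boole, Nat.cast_inj]
  -- the signature term: supersets of `w` inside `U`
  have hZ : ∑ z : ↥U, ((if (x : Finset β) ⊆ (z : Finset β) then (1 : ℤ) else 0) * (-1 : ℤ) ^ (k - #(z : Finset β)) *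
        (if (x' : Finset β) ⊆ (z : Finset β) then (1 : ℤ) else 0))
      = ∑ z ∈ U.filter (fun z => w ⊆ z), (-1 : ℤ) ^ (k - #z) := by
    have h1 : ∑ z : ↥U, ((if (x : Finset β) ⊆ (z : Finset β) then (1 : ℤ) else 0) * (-1 : ℤ) ^ (k - #(z : Finset β)) *
          (if (x' : Finset β) ⊆ (z : Finset β) then (1 : ℤ) else 0))
        = ∑ z ∈ U, (if w ⊆ z then (-1 : ℤ) ^ (k - #z) else 0) := by
      rw [univ_eq_attach, Finset.sum_attach U (fun z => (if (x : Finset β) ⊆ z then (1 : ℤ) else 0) * (-1 : ℤ) ^ (k - #z) *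
        (if (x' : Finset β) ⊆ z then (1 : ℤ) else 0))]
      apply Finset.sum_congr rfl
      intro z _
      have hiff : w ⊆ z ↔ (x : Finset β) ⊆ z ∧ (x' : Finset β) ⊆ z := by rw [hwdef, Finset.union_subset_iff]
      by_cases h1 : (x : Finset β) ⊆ (z : Finset β) <;> by_cases h2 : (x' : Finset β) ⊆ (z : Finset β)
      · have h3 : w ⊆ z := hiff.2 ⟨h1, h2⟩
        simp [h1, h2, h3]
      · have h3 : ¬ w ⊆ z := fun h => h2 (hiff.1 h).2
        simp [h1, h2, h3]
      · have h3 : ¬ w ⊆ z := fun h => h1 (hiff.1 h).1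
        simp [h1, h2, h3]
      · have h3 : ¬ w ⊆ z := fun h => h1 (hiff.1 h).1
        simp [h1, h2, h3]
    rw [h1, Finset.sum_filter]
  rw [hV, hZ]
  by_cases hwk : #w ≤ k
  · -- main case: both counts are binomials, then Pascal
    rw [card_filter_powersetCard_superset w (k + 1) (by omega), hβ,
      sum_filter_superset_neg_one_pow k U hUk hup (x : Finset β) w x.2 subset_union_left hwk (by omega), hβ]
    have e1 : 2 * k + 2 - #w = (2 * k + 1 - #w) + 1 := by omega
    have e2 : k + 1 - #w = (k - #w) + 1 := by omega
    have e3 : 2 * k + 2 - 1 - #w = 2 * k + 1 - #w := by omega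
    rw [e1, e2, e3, Nat.choose_succ_succ', Nat.cast_add, add_sub_cancel_left]
    congr 1
    exact Nat.choose_symm_of_eq_add (by omega)
  · -- degenerate cases: no member of `U` lies above `w`
    have hZ0 : U.filter (fun z => w ⊆ z) = ∅ := by
      rw [Finset.filter_eq_empty_iff]
      intro z hz hwz
      have := Finset.card_le_card hwz
      have := hUk z hz
      omega
    rw [hZ0, Finset.sum_empty, sub_zero]
    by_cases hw1 : #w = k + 1
    · rw [card_filter_powersetCard_superset w (k + 1) (by omega), hβ, hw1]
      have e1 : 2 * k + 2 - (k + 1) = k + 1 := by omega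
      have e2 : 2 * k + 1 - (k + 1) = k := by omega
      rw [e1, e2, Nat.sub_self, Nat.choose_zero_right, Nat.choose_self]
    · rw [filter_powersetCard_superset_eq_empty w (k + 1) (by omega), Finset.card_empty,
        Nat.choose_eq_zero_of_lt (by omega)]

end Summit.CriticalPhenomena.PercolationContinuityZ3.Theorems.AntiBandMiddleLevel
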